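import Summits.KontsevichZagierPeriods.KontsevichZagierPeriods.Theses.FurushoPentagon
import Literature.NumberTheory.Transcendental.MZVWordShuffle

/-!
# `PentagonInKZ`, line `logfree-gauge-corner-flatness`: shuffle = dissection, combinatorics

Support file (sub-stub `shuffleProduct_sumWord`) of the stub `stub_shuffleProduct` of the crux
`PentagonInKZ` (stmt-KontsevichZagierPeriods-11348, route FurushoPentagon): the finite
combinatorics of the interleavings of two words `u`, `v`, indexed by the COLOURINGS
`c : Fin (|u| + |v|) → Bool` of the merged positions with `|u|` positions coloured `true`
(= "this position carries a letter of `u`").  No definition and no notation is introduced; with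
the rank `rk_b(c, k) = #{k' < k | c k' = b}` the MERGED WORD of `c` is
`List.ofFn (k ↦ if c k then u[rk_true(c, k)] else v[rk_false(c, k)])`, written out.

* `sum_word` (= `shuffleProduct_sumWord`; subtype form `sum_word_subtype`): summing `f` over the
  merged words of all colourings is summing `f` over the list `u ш v` (`MZV.shuffleWord`, with
  multiplicity), by its defining recursion; hence merged words are interleavings
  (`word_mem_shuffleWord`);
* `exists_blockEquiv`, `blockEquiv_unique`: the BLOCK BIJECTION of a colouring (merged position ↦
  block coordinate: the increasing enumerations `Finset.orderEmbOfFin` of the two colour classes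
  glued by `Fin.append`, inverted) — increasing on both colour classes, `true` positions ↦ first
  block, reading the merged word blockwise as `u` and `v` — and its uniqueness.

References: C. Reutenauer, *Free Lie Algebras* (1993), §1.4; M. Eie, *The Theory of Multiple Zeta
Values with Applications in Combinatorics* (2013), §1.2 (shuffles of iterated integrals).
-/

noncomputable section

open Literature.NumberTheory.Transcendental

namespace Summit.KontsevichZagierPeriods.FurushoPentagon.PentagonInKZ

namespace ShuffleProduct

variable {N : ℕ}

/-! ## Colour counts, ranks and merged words along `Fin.cons` -/

/-- Colour count along `Fin.cons`. [folklore] -/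
theorem cnt_cons (b₀ : Bool) (c : Fin N → Bool) :
    (Finset.univ.filter (fun k => (Fin.cons b₀ c : Fin (N + 1) → Bool) k = true)).card =
      (Finset.univ.filter (fun k => c k = true)).card + (if b₀ = true then 1 else 0) := by
  rw [Fin.card_filter_univ_succ', add_comm]
  simp only [Fin.cons_zero, Fin.cons_succ]

/-- Rank along `Fin.cons`. [folklore] -/
theorem rank_cons_succ (b₀ : Bool) (c : Fin N → Bool) (b : Bool) (k : Fin N) :
    (Finset.univ.filter (fun k' => k' < k.succ ∧ (Fin.cons b₀ c : Fin (N + 1) → Bool) k' = b)).card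
      = (Finset.univ.filter (fun k' => k' < k ∧ c k' = b)).card + (if b₀ = b then 1 else 0) := by
  rw [Fin.card_filter_univ_succ', add_comm]
  simp only [Fin.cons_zero, Fin.cons_succ, Fin.succ_lt_succ_iff, Fin.succ_pos, true_and]

/-- Rank along a constant colouring. [folklore] -/
theorem rank_const (c : Fin N → Bool) (b : Bool) (hc : ∀ k, c k = b) (k : Fin N) :
    (Finset.univ.filter (fun k' => k' < k ∧ c k' = b)).card = k := by
  rw [show (Finset.univ.filter fun k' => k' < k ∧ c k' = b) = Finset.Iio k by ext k'; simp [hc k'],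
    Fin.card_Iio]

/-- The merged word along the all-`true` colouring is `u`. [folklore] -/
theorem word_const_true (u v : List (Fin 3)) (c : Fin N → Bool) (hc : ∀ k, c k = true)
    (hu : u.length = N) : List.ofFn (fun k => if c k = true
      then u.getD (Finset.univ.filter (fun k' => k' < k ∧ c k' = true)).card 0
      else v.getD (Finset.univ.filter (fun k' => k' < k ∧ c k' = false)).card 0) = u := by
  subst hu
  conv_lhs => enter [1, k]; rw [if_pos (hc k), rank_const c true hc k, List.getD_eq_get]
  exact List.ofFn_get u

/-- The merged word along the all-`false` colouring is `v`. [folklore] -/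
theorem word_const_false (u v : List (Fin 3)) (c : Fin N → Bool) (hc : ∀ k, c k = false)
    (hv : v.length = N) : List.ofFn (fun k => if c k = true
      then u.getD (Finset.univ.filter (fun k' => k' < k ∧ c k' = true)).card 0
      else v.getD (Finset.univ.filter (fun k' => k' < k ∧ c k' = false)).card 0) = v := by
  subst hv
  conv_lhs =>
    enter [1, k]
    rw [if_neg (by rw [hc k]; exact Bool.false_ne_true), rank_const c false hc k, List.getD_eq_get]
  exact List.ofFn_get v

/-- Merged word, first position coloured `true`. [cite: Reutenauer1993, §1.4] -/
theorem word_cons_true (a : Fin 3) (u v : List (Fin 3)) (c : Fin N → Bool) :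
    List.ofFn (fun k => if (Fin.cons true c : Fin (N + 1) → Bool) k = true
      then (a :: u).getD (Finset.univ.filter (fun k' =>
        k' < k ∧ (Fin.cons true c : Fin (N + 1) → Bool) k' = true)).card 0
      else v.getD (Finset.univ.filter (fun k' =>
        k' < k ∧ (Fin.cons true c : Fin (N + 1) → Bool) k' = false)).card 0) =
    a :: List.ofFn (fun k => if c k = true
      then u.getD (Finset.univ.filter (fun k' => k' < k ∧ c k' = true)).card 0
      else v.getD (Finset.univ.filter (fun k' => k' < k ∧ c k' = false)).card 0) := by
  rw [List.ofFn_succ]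
  congr 1
  · simp
  · congr 1
    funext k
    simp [rank_cons_succ]

/-- Merged word, first position coloured `false`. [cite: Reutenauer1993, §1.4] -/
theorem word_cons_false (b : Fin 3) (u v : List (Fin 3)) (c : Fin N → Bool) :
    List.ofFn (fun k => if (Fin.cons false c : Fin (N + 1) → Bool) k = true
      then u.getD (Finset.univ.filter (fun k' =>
        k' < k ∧ (Fin.cons false c : Fin (N + 1) → Bool) k' = true)).card 0
      else (b :: v).getD (Finset.univ.filter (fun k' =>
        k' < k ∧ (Fin.cons false c : Fin (N + 1) → Bool) k' = false)).card 0) =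
    b :: List.ofFn (fun k => if c k = true
      then u.getD (Finset.univ.filter (fun k' => k' < k ∧ c k' = true)).card 0
      else v.getD (Finset.univ.filter (fun k' => k' < k ∧ c k' = false)).card 0) := by
  rw [List.ofFn_succ]
  congr 1
  · simp
  · congr 1
    funext k
    simp [rank_cons_succ]

/-! ## The sum over colourings is the sum over `u ш v` -/

section Sum

variable {M : Type*} [AddCommMonoid M]

/-- Splitting a sum over colourings of `N + 1` positions by the first colour. [folklore] -/
theorem sum_cons_split (G : (Fin (N + 1) → Bool) → M) :
    ∑ c, G c =
      ∑ c : Fin N → Bool, G (Fin.cons true c) + ∑ c : Fin N → Bool, G (Fin.cons false c) := by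
  rw [← Fintype.sum_equiv (Fin.consEquiv fun _ => Bool) (fun p => G (Fin.cons p.1 p.2)) G
    (fun p => rfl), Fintype.sum_prod_type, Fintype.sum_bool]

/-- `[] ш v = v`, colouring form. [folklore] -/
theorem sum_word_nil_left (f : List (Fin 3) → M) (v : List (Fin 3)) (hv : v.length = N) :
    (∑ c : Fin N → Bool, if (Finset.univ.filter (fun k => c k = true)).card = 0
      then f (List.ofFn (fun k => if c k = true
        then [].getD (Finset.univ.filter (fun k' => k' < k ∧ c k' = true)).card 0
        else v.getD (Finset.univ.filter (fun k' => k' < k ∧ c k' = false)).card 0))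
      else 0) = f v := by
  rw [Finset.sum_eq_single (fun _ => false)]
  · rw [if_pos (by simp), word_const_false [] v _ (fun _ => rfl) hv]
  · intro c _ hc
    rw [if_neg]
    intro h0
    apply hc
    funext k
    have := (Finset.card_filter_eq_zero_iff.1 h0) k (Finset.mem_univ _)
    simpa using this
  · exact fun h => absurd (Finset.mem_univ _) h

/-- `u ш [] = u`, colouring form. [folklore] -/
theorem sum_word_nil_right (f : List (Fin 3) → M) (u : List (Fin 3)) (hu : u.length = N) :
    (∑ c : Fin N → Bool, if (Finset.univ.filter (fun k => c k = true)).card = u.length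
      then f (List.ofFn (fun k => if c k = true
        then u.getD (Finset.univ.filter (fun k' => k' < k ∧ c k' = true)).card 0
        else [].getD (Finset.univ.filter (fun k' => k' < k ∧ c k' = false)).card 0))
      else 0) = f u := by
  rw [Finset.sum_eq_single (fun _ => true)]
  · rw [if_pos (by simp [hu]), word_const_true u [] _ (fun _ => rfl) hu]
  · intro c _ hc
    rw [if_neg]
    intro h0
    apply hc
    funext k
    have h1 : (Finset.univ.filter fun k => c k = true).card =
        (Finset.univ : Finset (Fin N)).card := by
      rw [Finset.card_univ, Fintype.card_fin]
      exact h0.trans hu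
    exact (Finset.card_filter_eq_iff.1 h1) k (Finset.mem_univ _)
  · exact fun h => absurd (Finset.mem_univ _) h

/-- **Interleavings = colourings**: summing `f` over the merged words of all colourings with
`|u|` positions coloured `true` is summing `f` over `u ш v` (with multiplicity), by the recursion
`(a u) ш (b v) = a (u ш b v) + b (a u ш v)`. [cite: Reutenauer1993, §1.4] -/
theorem sum_word : ∀ (N : ℕ) (f : List (Fin 3) → M) (u v : List (Fin 3)),
    u.length + v.length = N →
    (∑ c : Fin N → Bool, if (Finset.univ.filter (fun k => c k = true)).card = u.length
      then f (List.ofFn (fun k => if c k = true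
        then u.getD (Finset.univ.filter (fun k' => k' < k ∧ c k' = true)).card 0
        else v.getD (Finset.univ.filter (fun k' => k' < k ∧ c k' = false)).card 0))
      else 0) = ((MZV.shuffleWord u v).map f).sum
  | N, f, [], v, h => by
    rw [MZV.shuffleWord_nil_left, List.map_singleton, List.sum_singleton]
    exact sum_word_nil_left f v (by simpa using h)
  | N, f, a :: u, [], h => by
    rw [MZV.shuffleWord_nil_right, List.map_singleton, List.sum_singleton]
    exact sum_word_nil_right f (a :: u) (by simpa using h)
  | 0, f, a :: u, b :: v, h => by simp at h
  | N + 1, f, a :: u, b :: v, h => by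
    rw [MZV.shuffleWord_cons_cons, List.map_append, List.sum_append, List.map_map, List.map_map,
      ← sum_word N (f ∘ List.cons a) u (b :: v) (by simp only [List.length_cons] at h ⊢; omega),
      ← sum_word N (f ∘ List.cons b) (a :: u) v (by simp only [List.length_cons] at h ⊢; omega),
      sum_cons_split]
    congr 1
    · refine Finset.sum_congr rfl fun c _ => ?_
      rw [cnt_cons, word_cons_true]
      simp
    · refine Finset.sum_congr rfl fun c _ => ?_
      rw [cnt_cons, word_cons_false]
      simp

end Sum

/-! ## Enumerating the two colour classes -/

/-- The rank inverts the increasing enumeration of a colour class. [folklore] -/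
theorem rank_orderEmbOfFin (c : Fin N → Bool) (b : Bool) {k : ℕ}
    (h : (Finset.univ.filter fun x => c x = b).card = k) (i : Fin k) :
    (Finset.univ.filter (fun k' =>
      k' < (Finset.univ.filter fun x => c x = b).orderEmbOfFin h i ∧ c k' = b)).card = i := by
  have hS : (Finset.univ.filter fun k' =>
      k' < (Finset.univ.filter fun x => c x = b).orderEmbOfFin h i ∧ c k' = b) =
      (Finset.Iio i).map ((Finset.univ.filter fun x => c x = b).orderEmbOfFin h).toEmbedding := by
    ext k'
    simp only [Finset.mem_filter, Finset.mem_univ, true_and, Finset.mem_map, Finset.mem_Iio,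
      RelEmbedding.coe_toEmbedding]
    constructor
    · rintro ⟨hlt, hk'⟩
      have hk'' : k' ∈ Set.range ((Finset.univ.filter fun x => c x = b).orderEmbOfFin h) := by
        rw [Finset.range_orderEmbOfFin]
        simpa using hk'
      obtain ⟨i', rfl⟩ := hk''
      exact ⟨i', (OrderEmbedding.lt_iff_lt _).1 hlt, rfl⟩
    · rintro ⟨i', hi', rfl⟩
      exact ⟨(OrderEmbedding.lt_iff_lt _).2 hi',
        (Finset.mem_filter.1 (Finset.orderEmbOfFin_mem _ h i')).2⟩
  rw [hS, Finset.card_map, Fin.card_Iio]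

/-- The two colour classes have `n` and `m` elements. [folklore] -/
theorem card_false {n m : ℕ} (c : Fin (n + m) → Bool)
    (hc : (Finset.univ.filter (fun k => c k = true)).card = n) :
    (Finset.univ.filter fun k => c k = false).card = m := by
  have h := Finset.card_filter_add_card_filter_not
    (s := (Finset.univ : Finset (Fin (n + m)))) (fun k => c k = true)
  simp only [Bool.not_eq_true, Finset.card_univ, Fintype.card_fin] at h
  omega

/-- **Uniqueness of the block bijection** of a colouring: a permutation of the merged positions
increasing on both colour classes and sending the `true` positions to the first block is
determined (by `Finset.orderEmbOfFin_unique` on the two classes). [folklore] -/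
theorem blockEquiv_unique {n m : ℕ} (c : Fin (n + m) → Bool)
    (hc : (Finset.univ.filter (fun k => c k = true)).card = n) (e e' : Fin (n + m) ≃ Fin (n + m))
    (h₁ : StrictMono fun i => e.symm (Fin.castAdd m i))
    (h₂ : StrictMono fun j => e.symm (Fin.natAdd n j)) (h₃ : ∀ k, c k = true ↔ (e k : ℕ) < n)
    (h₁' : StrictMono fun i => e'.symm (Fin.castAdd m i))
    (h₂' : StrictMono fun j => e'.symm (Fin.natAdd n j)) (h₃' : ∀ k, c k = true ↔ (e' k : ℕ) < n) :
    e = e' := by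
  have hT : ∀ g : Fin (n + m) ≃ Fin (n + m), StrictMono (fun i => g.symm (Fin.castAdd m i)) →
      (∀ k, c k = true ↔ (g k : ℕ) < n) → (fun i => g.symm (Fin.castAdd m i)) =
        ⇑((Finset.univ.filter (fun k => c k = true)).orderEmbOfFin hc) :=
    fun g hg hg₃ => Finset.orderEmbOfFin_unique hc
      (fun i => Finset.mem_filter.2 ⟨Finset.mem_univ _, (hg₃ _).2 (by simp)⟩) hg
  have hF : ∀ g : Fin (n + m) ≃ Fin (n + m), StrictMono (fun j => g.symm (Fin.natAdd n j)) →
      (∀ k, c k = true ↔ (g k : ℕ) < n) → (fun j => g.symm (Fin.natAdd n j)) =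
        ⇑((Finset.univ.filter (fun k => c k = false)).orderEmbOfFin (card_false c hc)) :=
    fun g hg hg₃ => Finset.orderEmbOfFin_unique (card_false c hc)
      (fun j => Finset.mem_filter.2 ⟨Finset.mem_univ _, by
        have h := hg₃ (g.symm (Fin.natAdd n j))
        simp only [Equiv.apply_symm_apply, Fin.val_natAdd] at h
        cases hcj : c (g.symm (Fin.natAdd n j))
        · rfl
        · exact absurd (h.1 hcj) (by omega)⟩) hg
  have hs : ⇑e.symm = ⇑e'.symm := by
    rw [← Fin.append_castAdd_natAdd (f := ⇑e.symm), ← Fin.append_castAdd_natAdd (f := ⇑e'.symm),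
      hT e h₁ h₃, hT e' h₁' h₃', hF e h₂ h₃, hF e' h₂' h₃']
  calc e = e.symm.symm := e.symm_symm.symm
    _ = e'.symm.symm := by rw [show e.symm = e'.symm from Equiv.ext (congrFun hs)]
    _ = e' := e'.symm_symm

/-! ## The interface of the dissection: merged words `W c` and their block bijections -/

section Interface

variable (u v : List (Fin 3)) (W : (Fin (u.length + v.length) → Bool) → List (Fin 3))
  (hW : ∀ c, W c = List.ofFn (fun k => if c k = true
    then u.getD (Finset.univ.filter (fun k' => k' < k ∧ c k' = true)).card 0
    else v.getD (Finset.univ.filter (fun k' => k' < k ∧ c k' = false)).card 0))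
include hW

/-- `sum_word` as a sum over the subtype of colourings with `|u|` positions coloured `true`.
[cite: Reutenauer1993, §1.4] -/
theorem sum_word_subtype {M : Type*} [AddCommMonoid M] (f : List (Fin 3) → M) :
    ∑ c : {c : Fin (u.length + v.length) → Bool //
      (Finset.univ.filter (fun k => c k = true)).card = u.length}, f (W c.1) =
      ((MZV.shuffleWord u v).map f).sum := by
  have h1 : ∑ c ∈ Finset.univ.filter (fun c : Fin (u.length + v.length) → Bool =>
      (Finset.univ.filter (fun k => c k = true)).card = u.length), f (W c) =
      ∑ c : {c : Fin (u.length + v.length) → Bool //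
        (Finset.univ.filter (fun k => c k = true)).card = u.length}, f (W c.1) :=
    Finset.sum_subtype (Finset.univ.filter (fun c : Fin (u.length + v.length) → Bool =>
        (Finset.univ.filter (fun k => c k = true)).card = u.length))
      (fun c => by
        rw [Finset.mem_filter]
        exact ⟨fun h => h.2, fun h => ⟨Finset.mem_univ _, h⟩⟩)
      (fun c => f (W c))
  rw [← h1, Finset.sum_filter]
  simp only [hW]
  exact sum_word _ f u v rfl

/-- Every merged word along a colouring with `|u|` positions coloured `true` is an interleaving
of `u` and `v`. [cite: Reutenauer1993, §1.4] -/
theorem word_mem_shuffleWord (c : Fin (u.length + v.length) → Bool)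
    (hc : (Finset.univ.filter (fun k => c k = true)).card = u.length) :
    W c ∈ MZV.shuffleWord u v := by
  have h := sum_word_subtype u v W hW (fun w => ({w} : Multiset (List (Fin 3))))
  rw [← Multiset.sum_coe, ← Multiset.map_coe, Multiset.sum_map_singleton] at h
  have hmem : W c ∈ ∑ c' : {c : Fin (u.length + v.length) → Bool //
      (Finset.univ.filter (fun k => c k = true)).card = u.length},
        ({W c'.1} : Multiset (List (Fin 3))) :=
    Multiset.mem_sum.2 ⟨⟨c, hc⟩, Finset.mem_univ _, Multiset.mem_singleton_self (W c)⟩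
  rw [h] at hmem
  exact Multiset.mem_coe.1 hmem

/-- **Existence of the block bijection** of a colouring `c` with `|u|` positions coloured `true`
(increasing enumerations of the two colour classes glued by `Fin.append`, inverted): increasing
on both colour classes, `true` positions ↦ first block, and reading the merged word `W c` along
it gives `u` on the first block and `v` on the second. [cite: Reutenauer1993, §1.4] -/
theorem exists_blockEquiv (c : Fin (u.length + v.length) → Bool)
    (hc : (Finset.univ.filter (fun k => c k = true)).card = u.length) :
    ∃ e : Fin (u.length + v.length) ≃ Fin (u.length + v.length),
      StrictMono (fun i => e.symm (Fin.castAdd v.length i)) ∧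
      StrictMono (fun j => e.symm (Fin.natAdd u.length j)) ∧
      (∀ k, c k = true ↔ (e k : ℕ) < u.length) ∧
      (∀ i, (W c).getD (e.symm (Fin.castAdd v.length i)) 0 = u.get i) ∧
      (∀ j, (W c).getD (e.symm (Fin.natAdd u.length j)) 0 = v.get j) := by
  have hTc : ∀ i, c ((Finset.univ.filter (fun k => c k = true)).orderEmbOfFin hc i) = true :=
    fun i => (Finset.mem_filter.1 (Finset.orderEmbOfFin_mem _ hc i)).2
  have hFc : ∀ j,
      c ((Finset.univ.filter (fun k => c k = false)).orderEmbOfFin (card_false c hc) j) = false :=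
    fun j => (Finset.mem_filter.1 (Finset.orderEmbOfFin_mem _ (card_false c hc) j)).2
  have hbij : Function.Bijective
      (Fin.append ⇑((Finset.univ.filter (fun k => c k = true)).orderEmbOfFin hc)
        ⇑((Finset.univ.filter (fun k => c k = false)).orderEmbOfFin (card_false c hc))) := by
    refine Finite.surjective_iff_bijective.1 fun k => ?_
    cases hk : c k
    · have hk' : k ∈ Set.range
          ((Finset.univ.filter (fun k => c k = false)).orderEmbOfFin (card_false c hc)) := by
        rw [Finset.range_orderEmbOfFin]
        simpa using hk
      obtain ⟨j, hj⟩ := hk'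
      exact ⟨Fin.natAdd u.length j, by rw [Fin.append_right, hj]⟩
    · have hk' : k ∈ Set.range ((Finset.univ.filter (fun k => c k = true)).orderEmbOfFin hc) := by
        rw [Finset.range_orderEmbOfFin]
        simpa using hk
      obtain ⟨i, hi⟩ := hk'
      exact ⟨Fin.castAdd v.length i, by rw [Fin.append_left, hi]⟩
  refine ⟨(Equiv.ofBijective _ hbij).symm, ?_, ?_, fun k => ?_, fun i => ?_, fun j => ?_⟩
  · simpa only [Equiv.symm_symm, Equiv.ofBijective_apply, Fin.append_left] using
      ((Finset.univ.filter (fun k => c k = true)).orderEmbOfFin hc).strictMono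
  · simpa only [Equiv.symm_symm, Equiv.ofBijective_apply, Fin.append_right] using
      ((Finset.univ.filter (fun k => c k = false)).orderEmbOfFin (card_false c hc)).strictMono
  · obtain ⟨a, rfl⟩ := hbij.2 k
    rw [Equiv.ofBijective_symm_apply_apply]
    induction a using Fin.addCases with
    | left i =>
      rw [Fin.append_left, Fin.val_castAdd]
      exact ⟨fun _ => i.2, fun _ => hTc i⟩
    | right j =>
      rw [Fin.append_right, Fin.val_natAdd, hFc]
      exact ⟨fun h => absurd h Bool.false_ne_true, fun h => absurd h (by omega)⟩
  · rw [Equiv.symm_symm, Equiv.ofBijective_apply, Fin.append_left, hW,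
      List.getD_eq_getElem _ _ (by simp), List.getElem_ofFn, Fin.eta, if_pos (hTc i),
      rank_orderEmbOfFin c true hc i, List.getD_eq_get]
  · rw [Equiv.symm_symm, Equiv.ofBijective_apply, Fin.append_right, hW,
      List.getD_eq_getElem _ _ (by simp), List.getElem_ofFn, Fin.eta,
      if_neg (by rw [hFc j]; exact Bool.false_ne_true),
      rank_orderEmbOfFin c false (card_false c hc) j, List.getD_eq_get]

end Interface

end ShuffleProduct

/-- **Sub-stub `shuffleProduct_sumWord`** (interleavings = colourings, written out): for words
`u`, `v` over `Fin 3`, summing `f` over the merged words of all colourings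
`c : Fin N → Bool` (`N = |u| + |v|`) with `|u|` positions coloured `true` — position `k` carrying
the next unused letter of `u` (colour `true`) or of `v` (colour `false`) — is summing `f` over the
list `u ш v` of interleavings with multiplicity. [cite: Reutenauer1993, §1.4] -/
theorem shuffleProduct_sumWord : ∀ (M : Type) [AddCommMonoid M] (N : ℕ) (f : List (Fin 3) → M) (u v : List (Fin 3)), u.length + v.length = N → (∑ c : Fin N → Bool, if (Finset.univ.filter (fun k => c k = true)).card = u.length then f (List.ofFn (fun k => if c k = true then u.getD (Finset.univ.filter (fun k' => k' < k ∧ c k' = true)).card 0 else v.getD (Finset.univ.filter (fun k' => k' < k ∧ c k' = false)).card 0)) else 0) = ((MZV.shuffleWord u v).map f).sum :=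
  fun _ _ N f u v h => ShuffleProduct.sum_word N f u v h

end Summit.KontsevichZagierPeriods.FurushoPentagon.PentagonInKZ
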